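import Literature.NumberTheory.EllipticCurves.BhargavaShankarUpperSieveSetReductionProofs
import HarnessLib

/-!
# Cor. 1.2 from the upper half of Thm 2.12 stated type by type (`i = 0, 2+, 1`) and the local
# integrals

`Proofs` file (theorems only: no definitions, no named facts). Source: M. Bhargava, A. Shankar,
*Binary quartic forms having bounded invariants, and the boundedness of the average rank of
elliptic curves*, Ann. of Math. (2) 181 (2015) 191–242, published version (= `arXiv:1006.1002v3`),
Thm 2.12 ("`N(S ∩ V_ℤ^{(i)}; X) = N(V_ℤ^{(i)}; X) ∏_p μ_p(S) + O(X^{3/4+ε})`") with the constants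
of Thm 2.1 (`N(V_ℤ^{(0)};X) ~ (4/135)ζ(2)X^{5/6}`, `N(V_ℤ^{(2+)};X) ~ (4/135)ζ(2)X^{5/6}` — one
half of `N(V_ℤ^{(2)};X) ~ (8/135)ζ(2)X^{5/6}` —, `N(V_ℤ^{(1)};X) ~ (32/135)ζ(2)X^{5/6}`), and
Cor. 1.2.

`BhargavaShankarUpperSieveSetReductionProofs` (tree) derives Cor. 1.2
(`Literature.NumberTheory.EllipticCurves.averageRankLE_three_halves`) from the local integrals
(F) and the upper congruence count (D_set) for the union `V_ℤ^{(0)} ∪ V_ℤ^{(2+)} ∪ V_ℤ^{(1)}`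
with the constant `8/27 = (4 + 4 + 32)/135`. Here (D_set) is obtained from its three type-by-type
instances — the form in which Thm 2.12 is printed — by `N((A ∪ B ∪ C) ∩ S̃; X) ≤ N(A ∩ S̃; X) +
N(B ∩ S̃; X) + N(C ∩ S̃; X)` (`gl2zClassCount_union_three_inter_le`), giving
**`averageRankLE_three_halves_of_upperCongruenceTypeCount`**: for every modulus `N`, every set of
residues `S ⊆ (ℤ/Nℤ)⁵` with `GL₂(ℤ)`-invariant pull-back `S̃` and every `ε > 0`, eventually
`N(V_ℤ^{(0)} ∩ S̃; X) ≤ (#S/N⁵·(4/135)ζ(2) + ε)X^{5/6}`, `N(V_ℤ^{(2+)} ∩ S̃; X) ≤ (#S/N⁵·(4/135)ζ(2) + ε)X^{5/6}`,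
`N(V_ℤ^{(1)} ∩ S̃; X) ≤ (#S/N⁵·(32/135)ζ(2) + ε)X^{5/6}` (upper halves of Thm 2.12), together with
(F) `∫ φ_p = |2¹⁰/3³|_p M_p(V,F)`, imply that the `limsup` of the average rank is `≤ 3/2`.

Finally (`integral_sievePhi_eq_setIntegral`,
`averageRankLE_three_halves_of_upperCongruenceTypeCount_setIntegral`) the local input (F), which
the assembly files take as the integral over `V_{ℤ_p}` of the function
`φ_p = (if f ∈ S_p(F) then 1/m_p(f) else 0)`, is identified with the set integral
`∫_{S_p(F)} 1/m_p(f) df` of Prop. 3.13 as printed ("the set `S_p(F)` consists of all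
`ℚ_p`-soluble binary quartic forms having invariants `2⁴I` and `2⁶J` with `(I,J) ∈ Inv_p(F)`";
`S_p(F)` is measurable by `BhargavaShankarSievePhiMeasurableProofs`), and the implication is
restated with (F) in that printed form `∫_{S_p(F)} 1/m_p = |2¹⁰/3³|_p · localMassV p`, where in
the tree's normalisation `localMassV p = Vol(PGL₂(ℤ_p)) · M_p(V,F)` (the factor `1 − p⁻²`).

## References

* M. Bhargava, A. Shankar, Ann. of Math. (2) 181 (2015) 191–242, Thms 2.1, 2.12 and Cor. 1.2;
  published numbering. [cite: BhargavaShankarAnnals2015, Thm 2.12 with the constants of Thm 2.1, and Cor. 1.2 (published numbering)]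
* M. Bhargava, A. Shankar, loc. cit., Prop. 3.13 and proof of Thm 3.19 (published numbering). [cite: BhargavaShankarAnnals2015, Prop. 3.13 (∫_{S_p(F)} 1/m_p; published numbering)]
-/

noncomputable section

open scoped Classical Topology
open Filter Set MeasureTheory Finset

namespace Literature.NumberTheory.EllipticCurves

namespace BinaryQuartic

/-- Subadditivity of `N(·; X)` over the three types inside a `GL₂(ℤ)`-invariant set `S'`:
`N((V^{(0)} ∪ V^{(2+)} ∪ V^{(1)}) ∩ S'; X) ≤ N(V^{(0)} ∩ S'; X) + N(V^{(2+)} ∩ S'; X) + N(V^{(1)} ∩ S'; X)`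
(the orbit set of the union is the union of the orbit sets; all are finite by reduction theory).
[cite: BhargavaShankarAnnals2015, Thm 2.1 (N(S;X)) and §5.4 eq. (31) (the three types)] -/
theorem gl2zClassCount_union_three_inter_le (S' : Set (BinaryQuartic ℤ)) (X : ℝ) :
    gl2zClassCount ((fourRealRoots ∪ posDefinite ∪ twoRealRoots) ∩ S') X ≤
      gl2zClassCount (fourRealRoots ∩ S') X + gl2zClassCount (posDefinite ∩ S') X +
        gl2zClassCount (twoRealRoots ∩ S') X := by
  unfold gl2zClassCount
  have hunion : gl2zOrbit '' {f : BinaryQuartic ℤ | f ∈ (fourRealRoots ∪ posDefinite ∪ twoRealRoots) ∩ S' ∧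
      f.IsIrreducible ∧ f.height < X} =
      gl2zOrbit '' {f | f ∈ fourRealRoots ∩ S' ∧ f.IsIrreducible ∧ f.height < X} ∪
        gl2zOrbit '' {f | f ∈ posDefinite ∩ S' ∧ f.IsIrreducible ∧ f.height < X} ∪
        gl2zOrbit '' {f | f ∈ twoRealRoots ∩ S' ∧ f.IsIrreducible ∧ f.height < X} := by
    rw [← Set.image_union, ← Set.image_union]
    congr 1
    ext f
    simp only [Set.mem_setOf_eq, Set.mem_union, Set.mem_inter_iff]
    tauto
  rw [hunion]
  exact (Set.ncard_union_le _ _).trans (Nat.add_le_add_right (Set.ncard_union_le _ _) _)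

/-- **(D_set) for the union from its three type-by-type instances** (upper halves of Thm 2.12 for
`V_ℤ^{(0)}`, `V_ℤ^{(2+)}`, `V_ℤ^{(1)}` with the constants `4/135`, `4/135`, `32/135` of Thm 2.1;
`4 + 4 + 32 = 40`, `40/135 = 8/27`). [cite: BhargavaShankarAnnals2015, Thm 2.12 with the constants of Thm 2.1 (published numbering)] -/
theorem upperCongruenceSetCount_of_typeCount
    (hT : ∀ (N : ℕ) [NeZero N] (S : Finset (Fin 5 → ZMod N)),
      (∀ f g : BinaryQuartic ℤ, GL2ZEquiv f g →
        ((fun j => ((g.coeffs j : ℤ) : ZMod N)) ∈ S ↔ (fun j => ((f.coeffs j : ℤ) : ZMod N)) ∈ S)) →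
      ∀ ε : ℝ, 0 < ε → ∀ᶠ X : ℝ in atTop,
        (gl2zClassCount (fourRealRoots ∩
            {f : BinaryQuartic ℤ | (fun j => ((f.coeffs j : ℤ) : ZMod N)) ∈ S}) X : ℝ) ≤
          ((S.card : ℝ) / (N : ℝ) ^ 5 * (4 / 135 * (Real.pi ^ 2 / 6)) + ε) * X ^ (5 / 6 : ℝ) ∧
        (gl2zClassCount (posDefinite ∩
            {f : BinaryQuartic ℤ | (fun j => ((f.coeffs j : ℤ) : ZMod N)) ∈ S}) X : ℝ) ≤
          ((S.card : ℝ) / (N : ℝ) ^ 5 * (4 / 135 * (Real.pi ^ 2 / 6)) + ε) * X ^ (5 / 6 : ℝ) ∧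
        (gl2zClassCount (twoRealRoots ∩
            {f : BinaryQuartic ℤ | (fun j => ((f.coeffs j : ℤ) : ZMod N)) ∈ S}) X : ℝ) ≤
          ((S.card : ℝ) / (N : ℝ) ^ 5 * (32 / 135 * (Real.pi ^ 2 / 6)) + ε) * X ^ (5 / 6 : ℝ))
    (N : ℕ) [NeZero N] (S : Finset (Fin 5 → ZMod N))
    (hS : ∀ f g : BinaryQuartic ℤ, GL2ZEquiv f g →
      ((fun j => ((g.coeffs j : ℤ) : ZMod N)) ∈ S ↔ (fun j => ((f.coeffs j : ℤ) : ZMod N)) ∈ S))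
    {ε : ℝ} (hε : 0 < ε) :
    ∀ᶠ X : ℝ in atTop,
      (gl2zClassCount ((fourRealRoots ∪ posDefinite ∪ twoRealRoots) ∩
          {f : BinaryQuartic ℤ | (fun j => ((f.coeffs j : ℤ) : ZMod N)) ∈ S}) X : ℝ) ≤
        ((S.card : ℝ) / (N : ℝ) ^ 5 * (8 / 27 * (Real.pi ^ 2 / 6)) + ε) * X ^ (5 / 6 : ℝ) := by
  filter_upwards [hT N S hS (ε / 3) (by positivity), eventually_ge_atTop 0] with X hX hX0
  obtain ⟨h0, h2, h1⟩ := hX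
  have hXpow : 0 ≤ X ^ (5 / 6 : ℝ) := Real.rpow_nonneg hX0 _
  have hle := gl2zClassCount_union_three_inter_le
    {f : BinaryQuartic ℤ | (fun j => ((f.coeffs j : ℤ) : ZMod N)) ∈ S} X
  calc (gl2zClassCount ((fourRealRoots ∪ posDefinite ∪ twoRealRoots) ∩
          {f : BinaryQuartic ℤ | (fun j => ((f.coeffs j : ℤ) : ZMod N)) ∈ S}) X : ℝ)
      ≤ (gl2zClassCount (fourRealRoots ∩ {f : BinaryQuartic ℤ | (fun j => ((f.coeffs j : ℤ) : ZMod N)) ∈ S}) X : ℝ) +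
          (gl2zClassCount (posDefinite ∩ {f : BinaryQuartic ℤ | (fun j => ((f.coeffs j : ℤ) : ZMod N)) ∈ S}) X : ℝ) +
          (gl2zClassCount (twoRealRoots ∩ {f : BinaryQuartic ℤ | (fun j => ((f.coeffs j : ℤ) : ZMod N)) ∈ S}) X : ℝ) := by
        exact_mod_cast hle
    _ ≤ ((S.card : ℝ) / (N : ℝ) ^ 5 * (4 / 135 * (Real.pi ^ 2 / 6)) + ε / 3) * X ^ (5 / 6 : ℝ) +
          ((S.card : ℝ) / (N : ℝ) ^ 5 * (4 / 135 * (Real.pi ^ 2 / 6)) + ε / 3) * X ^ (5 / 6 : ℝ) +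
          ((S.card : ℝ) / (N : ℝ) ^ 5 * (32 / 135 * (Real.pi ^ 2 / 6)) + ε / 3) * X ^ (5 / 6 : ℝ) :=
        add_le_add (add_le_add h0 h2) h1
    _ = ((S.card : ℝ) / (N : ℝ) ^ 5 * (8 / 27 * (Real.pi ^ 2 / 6)) + ε) * X ^ (5 / 6 : ℝ) := by ring

/-- **Bhargava–Shankar, Cor. 1.2 (`averageRankLE_three_halves`) from the type-by-type upper half of
Thm 2.12 and the local integrals (F).** See the module docstring.
[cite: BhargavaShankarAnnals2015, Cor. 1.2 with Thms 2.1, 2.12 and Prop. 3.13 (published numbering)] -/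
theorem averageRankLE_three_halves_of_upperCongruenceTypeCount
    (hT : ∀ (N : ℕ) [NeZero N] (S : Finset (Fin 5 → ZMod N)),
      (∀ f g : BinaryQuartic ℤ, GL2ZEquiv f g →
        ((fun j => ((g.coeffs j : ℤ) : ZMod N)) ∈ S ↔ (fun j => ((f.coeffs j : ℤ) : ZMod N)) ∈ S)) →
      ∀ ε : ℝ, 0 < ε → ∀ᶠ X : ℝ in atTop,
        (gl2zClassCount (fourRealRoots ∩
            {f : BinaryQuartic ℤ | (fun j => ((f.coeffs j : ℤ) : ZMod N)) ∈ S}) X : ℝ) ≤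
          ((S.card : ℝ) / (N : ℝ) ^ 5 * (4 / 135 * (Real.pi ^ 2 / 6)) + ε) * X ^ (5 / 6 : ℝ) ∧
        (gl2zClassCount (posDefinite ∩
            {f : BinaryQuartic ℤ | (fun j => ((f.coeffs j : ℤ) : ZMod N)) ∈ S}) X : ℝ) ≤
          ((S.card : ℝ) / (N : ℝ) ^ 5 * (4 / 135 * (Real.pi ^ 2 / 6)) + ε) * X ^ (5 / 6 : ℝ) ∧
        (gl2zClassCount (twoRealRoots ∩
            {f : BinaryQuartic ℤ | (fun j => ((f.coeffs j : ℤ) : ZMod N)) ∈ S}) X : ℝ) ≤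
          ((S.card : ℝ) / (N : ℝ) ^ 5 * (32 / 135 * (Real.pi ^ 2 / 6)) + ε) * X ^ (5 / 6 : ℝ))
    (hF : ∀ (p : ℕ) [Fact p.Prime],
      ∫ f : BinaryQuartic ℤ_[p],
          (if (f.map PadicInt.Coe.ringHom).IsSoluble ∧
              (∃ IJ ∈ invariantPairsAdic p, f.I = 2 ^ 4 * IJ.1 ∧ f.J = 2 ^ 6 * IJ.2)
            then (1 : ℝ) / localWeight f else 0) =
        ((padicNorm p (2 ^ 10 / 3 ^ 3) : ℚ) : ℝ) * localMassV p) :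
    averageRankLE_three_halves :=
  averageRankLE_three_halves_of_upperCongruenceSetCount
    (fun N _ S hS _ hε => upperCongruenceSetCount_of_typeCount hT N S hS hε) hF

/-! ## The local integral as the printed set integral over `S_p(F)` (Prop. 3.13) -/

variable (p : ℕ) [Fact p.Prime]

/-- `S_p(F)` (the `ℚ_p`-soluble forms with invariants in `2⁴F_p^{inv} × 2⁶F_p^{inv}`) is a
measurable subset of `V_{ℤ_p}`. [cite: BhargavaShankarAnnals2015, Prop. 3.13 (S_p(F); published numbering)] -/
theorem measurableSet_solubleInvariantSet :
    MeasurableSet {f : BinaryQuartic ℤ_[p] | (f.map PadicInt.Coe.ringHom).IsSoluble ∧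
      (∃ IJ ∈ invariantPairsAdic p, f.I = 2 ^ 4 * IJ.1 ∧ f.J = 2 ^ 6 * IJ.2)} :=
  (measurableSet_setOf_isSoluble p).inter (measurableSet_setOf_exists_invariantPairsAdic p)

/-- **`∫_{V_{ℤ_p}} φ_p dμ_p = ∫_{S_p(F)} 1/m_p(f) df`**: the integral of the local sieve weight is
the set integral of `1/m_p` over `S_p(F)` (the left side of Prop. 3.13 as printed).
[cite: BhargavaShankarAnnals2015, Prop. 3.13 and proof of Thm 3.19 (published numbering)] -/
theorem integral_sievePhi_eq_setIntegral :
    ∫ f : BinaryQuartic ℤ_[p],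
        (if (f.map PadicInt.Coe.ringHom).IsSoluble ∧
            (∃ IJ ∈ invariantPairsAdic p, f.I = 2 ^ 4 * IJ.1 ∧ f.J = 2 ^ 6 * IJ.2)
          then (1 : ℝ) / localWeight f else 0) =
      ∫ f in {f : BinaryQuartic ℤ_[p] | (f.map PadicInt.Coe.ringHom).IsSoluble ∧
          (∃ IJ ∈ invariantPairsAdic p, f.I = 2 ^ 4 * IJ.1 ∧ f.J = 2 ^ 6 * IJ.2)},
        (1 : ℝ) / localWeight f := by
  rw [← integral_indicator (measurableSet_solubleInvariantSet p)]
  refine integral_congr_ae (Eventually.of_forall fun f => ?_)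
  simp only [Set.indicator_apply, Set.mem_setOf_eq]

variable {p}

/-- **Cor. 1.2 (`averageRankLE_three_halves`) from the type-by-type upper half of Thm 2.12 and
Prop. 3.13 in its printed form** `∫_{S_p(F)} 1/m_p = |2¹⁰/3³|_p · localMassV p`
(`localMassV p = Vol(PGL₂(ℤ_p)) · M_p(V,F)`).
[cite: BhargavaShankarAnnals2015, Cor. 1.2 with Thm 2.12 and Prop. 3.13 (published numbering)] -/
theorem averageRankLE_three_halves_of_upperCongruenceTypeCount_setIntegral
    (hT : ∀ (N : ℕ) [NeZero N] (S : Finset (Fin 5 → ZMod N)),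
      (∀ f g : BinaryQuartic ℤ, GL2ZEquiv f g →
        ((fun j => ((g.coeffs j : ℤ) : ZMod N)) ∈ S ↔ (fun j => ((f.coeffs j : ℤ) : ZMod N)) ∈ S)) →
      ∀ ε : ℝ, 0 < ε → ∀ᶠ X : ℝ in atTop,
        (gl2zClassCount (fourRealRoots ∩
            {f : BinaryQuartic ℤ | (fun j => ((f.coeffs j : ℤ) : ZMod N)) ∈ S}) X : ℝ) ≤
          ((S.card : ℝ) / (N : ℝ) ^ 5 * (4 / 135 * (Real.pi ^ 2 / 6)) + ε) * X ^ (5 / 6 : ℝ) ∧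
        (gl2zClassCount (posDefinite ∩
            {f : BinaryQuartic ℤ | (fun j => ((f.coeffs j : ℤ) : ZMod N)) ∈ S}) X : ℝ) ≤
          ((S.card : ℝ) / (N : ℝ) ^ 5 * (4 / 135 * (Real.pi ^ 2 / 6)) + ε) * X ^ (5 / 6 : ℝ) ∧
        (gl2zClassCount (twoRealRoots ∩
            {f : BinaryQuartic ℤ | (fun j => ((f.coeffs j : ℤ) : ZMod N)) ∈ S}) X : ℝ) ≤
          ((S.card : ℝ) / (N : ℝ) ^ 5 * (32 / 135 * (Real.pi ^ 2 / 6)) + ε) * X ^ (5 / 6 : ℝ))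
    (hF : ∀ (p : ℕ) [Fact p.Prime],
      ∫ f in {f : BinaryQuartic ℤ_[p] | (f.map PadicInt.Coe.ringHom).IsSoluble ∧
          (∃ IJ ∈ invariantPairsAdic p, f.I = 2 ^ 4 * IJ.1 ∧ f.J = 2 ^ 6 * IJ.2)},
        (1 : ℝ) / localWeight f =
        ((padicNorm p (2 ^ 10 / 3 ^ 3) : ℚ) : ℝ) * localMassV p) :
    averageRankLE_three_halves :=
  averageRankLE_three_halves_of_upperCongruenceTypeCount hT fun p _ => by
    rw [integral_sievePhi_eq_setIntegral p]
    exact hF p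

end BinaryQuartic

end Literature.NumberTheory.EllipticCurves

end
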